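import Summits.BirchSwinnertonDyer.BirchSwinnertonDyer.Theorems.PrintCf2SplitBadTwoKummerStrictAtV
import Summits.BirchSwinnertonDyer.BirchSwinnertonDyer.Theorems.PrintCf2SplitBadTwoCMShaBottomValueOfCmScalar
import Summits.BirchSwinnertonDyer.BirchSwinnertonDyer.Theorems.PrintCf2SplitBadTwoCMShaLocalScalarInputTorsion
import Summits.BirchSwinnertonDyer.BirchSwinnertonDyer.Theorems.PrintCf2SplitBadTwoLocalKummerDivisibility
import Summits.BirchSwinnertonDyer.BirchSwinnertonDyer.Theorems.PrintCf2SplitBadTwoLocalPointsScalarDyadic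
import Summits.BirchSwinnertonDyer.BirchSwinnertonDyer.Theorems.PrintCf2SplitBadTwoCMShaModule
import Literature.NumberTheory.EllipticCurves.IsogenyBaseChangeFieldProofs
import HarnessLib

/-!
# Crux `PrintCf2.SplitBadTwoRankOneOfFacts` (stmt-BirchSwinnertonDyer-20368), road α v10.3, S3c input (F3): THE CM SCALAR AT `v`
# — on every S3c frame the complex multiplication `π` acts on `E(K_v) ⊗ ℤ₂` modulo torsion as `1 − r`, NOT `r`: (H1-pts) and
# (H1″)-for-all-local-points at `v` are THEOREMS

Cell `bsd-print-cf2`, EXTRA WIDTH seat `bsd-line-cf2-p1-w3` g10 (prover-bsd-line-cf2-p1-w3-g10-0); `--supports stmt-BirchSwinnertonDyer-20368`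
(helper, Theses-free). HONEST FRAMING: nothing here closes the crux or a registered stub; BSD is not proved by any of this; no summit statement
is proved by this seat. No definition, no named fact, no `sorry`, no kit. beyond-print theorem: no.

WHY. After cut 14 (p677854) + `hF1_holds` (p677936) + `hH2_holds` (p678559), S3c `stub_restrictedControl_two` hangs on (F3) alone
(`hF3_of_levelCounts`, p678471). Both roads to (F3) — -w8 g3's PLAIN road (hypothesis `hα` of `…KummerOutsideEigen`: «the `W*`-part of a
local Kummer class at `v` is the class of a RATIONAL TORSION point») and -w4 g9 + -w5 g3's A‴ count (the CM-check «`ẽ′_N`-projected Kummer classes are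
Kummer off `v` and `⊥ L_v`», the constant `#(N^E_v)_e = #W*(K_v)`, the point index `[E(K_v) : E(K) + 2^k E(K_v)] = 2^ℓ` in the case
`d ≡ 3 (8)`) — need ONE local CM input at the pinned place `v`: the `W* = E[𝔮_r^∞]`-idempotent kills `E(K_v) ⊗ ℚ₂/ℤ₂`, i.e. `π` acts on the
`ℤ₂`-line `E(K_v)/tors` (Silverman VII.6.3, `K_v ≅ ℚ₂`) by the root `1 − r` of `X² − X + 2` and not by `r`. -w7 g3's
`…LocalPointsScalarDyadic` proved the DICHOTOMY `c ∈ {r, 1 − r}` and wrote «WHAT THIS DOES NOT DO: decide WHICH of `r`, `1 − r` is the scalar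
… that bit is the content of (H1′)». (H1′) is now a theorem (-w3 g9 `comap_kummer_le_ker_resOfLe_of_frame_of_cyclic`, p673486, by branch
EXCLUSION from the global finiteness `Finite 𝔖_v(K, W*′)`), and THIS FILE decides the bit:
* §1 `cmScalar_dichotomy_localPoints` — the dichotomy TRANSPORTED to the `Γ_{K_v}`-fixed points of `E(K̄_v)` and the local points map
  `φ_{K_v}` of an isogeny `φ` with `φ² = φ − 2` (Galois descent `exists_map_eq_of_forall_smul_localPoints_eq`; the relation `φ_{K_v}² = φ_{K_v} − 2`
  on ALL of `E(K̄_v)` by rigidity, `Isogeny.apply_apply_add_smul_of_baseChange_field`): `∃ c ∈ {r, 1 − r}` with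
  «`∀ y` fixed, `∀ n`, `m·(φ_{K_v} y − N₁ y − 2^n y′) = 0`, `N₁ ≡ c (2^n)`, `m ≠ 0`, `y′` fixed».
* §2 **`cmScalar_localPoints_of_frame`** — ON EVERY S3c FRAME THE SCALAR IS `1 − r`. If it were `r = 1 − (1 − r)`, -w8 g2's
  `comap_localKerOver_le_ker_resOfLe_of_cmScalar_torsion` (p671811) AT THE CONJUGATE ROOT gives (H1″) for `W*′ = E[𝔮_{1−r}^∞]`: every
  `W*′`-class classical at `v` dies at `v`. The `W*′`-component of the level-`n` Kummer class `x_n = res_⊤ κ_n(P_K)` of the ℚ-generator IS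
  classical at `v` (`x_n` is; its `W*`-component `ι_* e_* x_n` is a Kummer class by stability (S) `resSubgroup_kummer_stable`, hence ZERO at `v`
  by (H1′), hence classical, `ker_resOfLe_le_comap_localKerOver`), so BOTH components die at `v`: `loc_v x_n = 0` for every `n`; by -w6 g3's
  local Kummer dictionary (`resOfLe_resSubgroup_kummerMapLevel_eq_zero_iff`, p676883) `P_K ∈ 2^n E(K_v) + tors` for every `n`, so `P` is
  torsion (-w7 g3 `isOfFinAddOrder_of_forall_exists_adicCompletion_two`) — contradiction.
* §3 **`hPts_holds`** — the hypothesis `hPts` of -w8 g2's `rBV_of_factor_values_of_cmScalar` (p671611), VERBATIM (`f_v := φ.localPointsMap K_v`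
  for the isogeny realising `π`, `exists_isogeny_apply_eq_cmEndo`); **`comap_localKerOver_le_ker_resOfLe_of_frame`** — (H1″) FOR ALL LOCAL
  POINTS at `v` on every frame: «`ι_*⁻¹(localKerOver 2 ⊤ K_v) ≤ ker res_{⊤ ⊓ D_v}` on `H¹(⊤, W*)`» (the tree had it for global Kummer /
  Selmer classes only: (H1′) p673486/p677687, (H1-Sel) p673910/p677409).
USE: -w8 g3's `hα` («`∀ c ∈ 𝓚_v, ∃ P ∈ E(K) torsion, H¹(ẽ_N) c = loc_v κ(P)`») and -w4 g10's (LF.2)/CM-check are level-`N` shadows of (H1″)-all;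
the point index of the PLAIN road in the case `d ≡ 3 (8)` needs «`πP ≡ (1 − r)P` mod `2^n E(K_v) + tors`» = `hPts_holds` at `y = P_K`.
presearch: «CM elliptic curve, action of the endomorphism on the formal group at a split prime, which eigen-summand is the formal group»
→ [corpus:silverman1994-advanced-topics II §1–§2 (normalised `[α]^* ω = αω`, pp. 103/140)], [corpus: Rubin1999 (LNM 1716) §3 Lemma 3.6 (ii), Cor. 3.17],
[corpus: Agboola2007 §6 Prop. 6.11 (arXiv p0014)] — the printed proofs go through the formal group (analytic normalisation); here the bit is decided
ALGEBRAICALLY from (H1′) (tree) — no Literature fact filed; galaxy «formal group|split prime» (star all) → no mathematical hit. playbook: none fit.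

References: [Rubin1999] §3 Lemma 3.6 (ii), Cor. 3.17; [Agboola2007] §6 Prop. 6.11; [GreenbergLNM1716] §2 Prop. 2.1–2.2; [SilvermanAEC2009]
Prop. VII.6.3, III.§4 (Thm. 4.8, Cor. 4.9), VIII §1–§2.
-/

noncomputable section

open scoped Classical

set_option linter.dupNamespace false
set_option autoImplicit false

open NumberField IsDedekindDomain Field WeierstrassCurve
open Literature.NumberTheory.EllipticCurves Literature.NumberTheory.EllipticCurves.GreenbergSelmer
open Literature.NumberTheory.EllipticCurves.Castella2018.AcSelmer
open Literature.NumberTheory.EllipticCurves.Agboola2007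
open Literature.NumberTheory.EllipticCurves.ResKernel
open Literature.NumberTheory.GaloisRepresentations

namespace Summit.BirchSwinnertonDyer.BirchSwinnertonDyer.Theorems.PrintCf2.CMPrimes

open Summit.BirchSwinnertonDyer.BirchSwinnertonDyer.Theorems.PrintCf2.RestrictedSelmerPair
open Summit.BirchSwinnertonDyer.BirchSwinnertonDyer.Theorems.PrintCf2.AdditiveAtSeven
open Summit.BirchSwinnertonDyer.BirchSwinnertonDyer.Theorems.PrintCf2.LocalTrichotomy
open Summit.BirchSwinnertonDyer.BirchSwinnertonDyer.Theorems.PrintCf2.LocalPointsScalar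

variable {K : Type} [Field K] [NumberField K]

/-! ## §1. The dichotomy on the `Γ_{K_v}`-fixed points of `E(K̄_v)` -/

/-- **The CM-scalar dichotomy for the local points map of an isogeny.** `K` quadratic with two places `v ≠ v̄` above `2` (`K_v ≅ ℚ₂`),
`V/K` elliptic, `φ : V → V` a `K`-isogeny with `φ(φP) = φP − 2P`, `r` a `2`-adic root of `X² − X + 2`. Then there is `c ∈ {r, 1 − r}` such
that for every `Γ_{K_v}`-fixed `y ∈ E(K̄_v)` and every `n`: `m · (φ_{K_v} y − N₁ y − 2^n y′) = 0` for some fixed `y′`, some integer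
`N₁ ≡ c (mod 2^n)` and some integer `m ≠ 0` (`φ_{K_v} = φ.localPointsMap K_v`). Transport of -w7 g3's `scalar_dichotomy_two` along Galois
descent; the quadratic relation holds on all of `E(K̄_v)` by rigidity. [cite: SilvermanAEC2009, Prop. VII.6.3, III.§4 Cor. 4.9, VIII §1]
[cite: Rubin1999, §3 Lemma 3.6 (ii)] -/
theorem cmScalar_dichotomy_localPoints (hK2 : Module.finrank ℚ K = 2)
    {v vbar : HeightOneSpectrum (𝓞 K)} (hv : ((2 : ℕ) : 𝓞 K) ∈ v.asIdeal) (hvbar : ((2 : ℕ) : 𝓞 K) ∈ vbar.asIdeal)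
    (hne : vbar ≠ v) (V : WeierstrassCurve K) [V.IsElliptic] (φ : Isogeny V V) (hφ : ∀ P, φ (φ P) = φ P - 2 • P)
    {r : ℤ_[2]} (hr : r * r = r - 2) :
    ∃ c : ℤ_[2], (c = r ∨ c = 1 - r) ∧
      ∀ y : localPoints V (v.adicCompletion K), (∀ σ : absoluteGaloisGroup (v.adicCompletion K), σ • y = y) →
        ∀ n : ℕ, ∃ (y' : localPoints V (v.adicCompletion K)) (N₁ : ℤ) (m : ℤ),
          (∀ σ : absoluteGaloisGroup (v.adicCompletion K), σ • y' = y') ∧ m ≠ 0 ∧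
          ((N₁ : ℤ_[2]) - c) ∈ (Ideal.span {(2 : ℤ_[2]) ^ n} : Ideal ℤ_[2]) ∧
          m • (φ.localPointsMap (v.adicCompletion K) y - N₁ • y - 2 ^ n • y') = 0 := by
  haveI : Fact (Nat.Prime 2) := ⟨Nat.prime_two⟩
  set E := v.adicCompletion K with hE
  haveI : CharZero E := charZero_of_injective_algebraMap (algebraMap K E).injective
  haveI : (V.baseChange E).IsElliptic := inferInstanceAs ((V.map (algebraMap K E)).IsElliptic)
  set fE : localPoints V E →+ localPoints V E := φ.localPointsMap E with hfE
  set ψ : (V.baseChange E).toAffine.Point →+ localPoints V E :=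
    Affine.Point.map (W' := V) (IsScalarTower.toAlgHom K E (AlgebraicClosure E)) with hψ
  have hψinj : Function.Injective ψ :=
    Affine.Point.map_injective (W' := V) (IsScalarTower.toAlgHom K E (AlgebraicClosure E))
  have hψfix : ∀ (Y : (V.baseChange E).toAffine.Point) (σ : absoluteGaloisGroup E), σ • ψ Y = ψ Y :=
    fun Y σ ↦ smul_map_baseChange_eq V E ψ hψ Y σ
  -- Galois descent of `φ_{K_v}` to `E(K_v)`
  have hex : ∀ Y : (V.baseChange E).toAffine.Point, ∃ Z : (V.baseChange E).toAffine.Point, ψ Z = fE (ψ Y) := by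
    intro Y
    have hfix : ∀ σ : absoluteGaloisGroup E, σ • fE (ψ Y) = fE (ψ Y) := fun σ ↦ by
      rw [hfE, ← φ.localPointsMap_smul, hψfix]
    obtain ⟨Z, hZ⟩ := exists_map_eq_of_forall_smul_localPoints_eq V E hfix
    exact ⟨Z, hZ⟩
  choose g hg using hex
  let fA : (V.baseChange E).toAffine.Point →+ (V.baseChange E).toAffine.Point :=
    AddMonoidHom.mk' g (fun Y Z ↦ hψinj (by rw [hg, map_add, map_add, map_add, hg, hg]))
  have hfA : ∀ Y, ψ (fA Y) = fE (ψ Y) := fun Y ↦ hg Y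
  -- the quadratic relation on all of `E(K̄_v)` (rigidity), hence on `E(K_v)`
  have hφ' : ∀ P : V.geomPoints, φ (φ P) + (-1 : ℤ) • φ P = (-2 : ℤ) • P := fun P ↦ by
    rw [hφ, neg_smul, one_smul, neg_smul, two_zsmul, two_nsmul]
    abel
  obtain ⟨φE, hφE, hφEq, -⟩ := Isogeny.exists_baseChange_field E φ
  have hrelE : ∀ q : localPoints V E, fE (fE q) = fE q - (2 : ℤ) • q := by
    intro q
    have h := Isogeny.apply_apply_add_smul_of_baseChange_field E φ hφ' φE hφE (localPointsEquivGeomPoints V E q)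
    rw [hφEq (localPointsEquivGeomPoints V E q), AddEquiv.symm_apply_apply, hφEq, AddEquiv.symm_apply_apply] at h
    -- `h : θ (fE (fE q)) + (-1) • θ (fE q) = (-2) • θ q`
    have h2 : localPointsEquivGeomPoints V E (fE (fE q) + (-1 : ℤ) • fE q) =
        localPointsEquivGeomPoints V E ((-2 : ℤ) • q) := by
      rw [map_add, map_zsmul, map_zsmul]; exact h
    have h3 : fE (fE q) + (-1 : ℤ) • fE q = (-2 : ℤ) • q := (localPointsEquivGeomPoints V E).injective h2
    have h' : fE (fE q) = (-2 : ℤ) • q - (-1 : ℤ) • fE q := eq_sub_of_add_eq h3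
    rw [h', neg_smul, neg_smul, one_smul, sub_neg_eq_add, neg_add_eq_sub]
  have hfA2 : ∀ x, fA (fA x) = fA x - (2 : ℤ) • x := fun x ↦
    hψinj (by rw [hfA, hfA, map_sub, map_zsmul, hfA, hrelE])
  obtain ⟨c, hc, hcA⟩ := scalar_dichotomy_two hK2 hv hvbar hne (V.baseChange E) fA hfA2 hr
  refine ⟨c, hc, fun y hy n ↦ ?_⟩
  obtain ⟨Y, hY⟩ := exists_map_eq_of_forall_smul_localPoints_eq V E hy
  have hY' : ψ Y = y := hY
  obtain ⟨N₁, hN₁⟩ := exists_int_sub_mem_span (p := 2) c n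
  obtain ⟨Y', hY''⟩ := hcA n N₁ hN₁ Y
  obtain ⟨m, hm0, hm⟩ := (isOfFinAddOrder_iff_nsmul_eq_zero).mp (ψ.isOfFinAddOrder hY'')
  refine ⟨ψ Y', N₁, (m : ℤ), fun σ ↦ hψfix Y' σ, by exact_mod_cast hm0.ne', hN₁, ?_⟩
  have hψeq : ψ (fA Y - N₁ • Y - ((2 : ℤ) ^ n) • Y') = fE y - N₁ • y - 2 ^ n • ψ Y' := by
    rw [map_sub, map_sub, hfA, map_zsmul, map_zsmul, hY', ← natCast_zsmul (ψ Y') (2 ^ n), Nat.cast_pow, Nat.cast_ofNat]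
  rw [natCast_zsmul, ← hψeq]
  exact hm

/-! ## §2. On the S3c frame the scalar is `1 − r` -/

/-- **The branch `c = r` is impossible** (generic form). `K` quadratic with `2 = v·v̄`, `V/K` elliptic, `π ∈ End_K(V)`, `r² = r − 2` with the
two eigen-summands `E[𝔮_r^∞]`, `E[𝔮_{1−r}^∞]` complementary, `φ` an isogeny acting as `π`. IF (H1′) holds at `v` for `W* = E[𝔮_r^∞]` (the
`W*`-components of the global Kummer classes die on `D_v`) AND `π` acted on `E(K_v)/tors` as the scalar `r` (the `m`-form scalar statement with
`N₁ ≡ r`), THEN every `K`-point of `V` is torsion: -w8 g2's (H1″) ⟸ (H1-pts) at the conjugate root kills the `W*′`-components of the level-`n`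
Kummer classes `res_⊤ κ_n(P)` at `v` (they are classical at `v`), (H1′) kills the `W*`-components (stability (S)), so `loc_v res_⊤ κ_n(P) = 0` for
all `n`, i.e. `P ∈ 2^n E(K_v) + tors` for all `n` (-w6 g3), i.e. `P` is torsion (-w7 g3). [cite: GreenbergLNM1716, §2 Prop. 2.1–2.2]
[cite: Agboola2007, §6 Prop. 6.11 (arXiv p0014)] [cite: SilvermanAEC2009, Prop. VII.6.3, VIII §2] -/
theorem isOfFinAddOrder_of_cmScalar_eq_root (hK2 : Module.finrank ℚ K = 2)
    {v vbar : HeightOneSpectrum (𝓞 K)} (hv : ((2 : ℕ) : 𝓞 K) ∈ v.asIdeal) (hvbar : ((2 : ℕ) : 𝓞 K) ∈ vbar.asIdeal) (hne : vbar ≠ v)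
    (V : WeierstrassCurve K) [V.IsElliptic] (π : V.endRing) {r : ℤ_[2]} (hr : r * r = r - 2)
    (hinf : V.endEigenPrimaryTorsion 2 π r ⊓ V.endEigenPrimaryTorsion 2 π (1 - r) = ⊥)
    (hsup : V.endEigenPrimaryTorsion 2 π r ⊔ V.endEigenPrimaryTorsion 2 π (1 - r) = ⊤)
    (φ : Isogeny V V) (hφ : ∀ Q, φ Q = (π : AddMonoid.End V.geomPoints) Q)
    (h1 : (((V.kummerMapPInfty 2 V.zsmul_geomPoints_surjective_holds).range).map (resSubgroup ⊤ (V.geomPrimaryTorsion 2))).comap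
        (resH1Hom (ContinuousMonoidHom.id (⊤ : Subgroup (absoluteGaloisGroup K))) (V.endEigenPrimaryTorsion 2 π r).subtype
          (fun _ _ ↦ rfl)) ≤
      (resOfLe ↥(V.endEigenPrimaryTorsion 2 π r) (inf_le_left : ⊤ ⊓ decomp v ≤ ⊤)).ker)
    (H : ∀ y : localPoints V (v.adicCompletion K), (∀ σ : absoluteGaloisGroup (v.adicCompletion K), σ • y = y) →
      ∀ n : ℕ, ∃ (y' : localPoints V (v.adicCompletion K)) (N₁ : ℤ) (m : ℤ),
        (∀ σ : absoluteGaloisGroup (v.adicCompletion K), σ • y' = y') ∧ m ≠ 0 ∧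
        ((N₁ : ℤ_[2]) - r) ∈ (Ideal.span {(2 : ℤ_[2]) ^ n} : Ideal ℤ_[2]) ∧
        m • (φ.localPointsMap (v.adicCompletion K) y - N₁ • y - 2 ^ n • y') = 0)
    (PK : V.toAffine.Point) : IsOfFinAddOrder PK := by
  haveI : Fact (Nat.Prime 2) := ⟨Nat.prime_two⟩
  set E := v.adicCompletion K with hE
  have hunit : IsUnit (r - (1 - r)) := (two_dvd_or_two_dvd_one_sub_of_root hr).2
  -- (H1″) for the conjugate summand `E[𝔮_{1-r}^∞]`, from the scalar `r = 1 - (1 - r)` (-w8 g2 at the root `1 - r`)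
  have hinf' : V.endEigenPrimaryTorsion 2 π (1 - r) ⊓ V.endEigenPrimaryTorsion 2 π (1 - (1 - r)) = ⊥ := by
    rw [sub_sub_cancel, inf_comm]; exact hinf
  have hsup' : V.endEigenPrimaryTorsion 2 π (1 - r) ⊔ V.endEigenPrimaryTorsion 2 π (1 - (1 - r)) = ⊤ := by
    rw [sub_sub_cancel, sup_comm]; exact hsup
  have hunit' : IsUnit ((1 - r) - (1 - (1 - r))) := by
    rw [sub_sub_cancel, ← neg_sub]; exact hunit.neg
  have H' : ∀ y : localPoints V E, (∀ σ : absoluteGaloisGroup E, σ • y = y) →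
      ∀ n : ℕ, ∃ (y' : localPoints V E) (N₁ : ℤ) (m : ℤ), (∀ σ : absoluteGaloisGroup E, σ • y' = y') ∧ m ≠ 0 ∧
        ((N₁ : ℤ_[2]) - (1 - (1 - r))) ∈ (Ideal.span {(2 : ℤ_[2]) ^ n} : Ideal ℤ_[2]) ∧
        m • (φ.localPointsMap E y - N₁ • y - 2 ^ n • y') = 0 := fun y hy n ↦ by
    obtain ⟨y', N₁, m, h1, h2, h3, h4⟩ := H y hy n
    exact ⟨y', N₁, m, h1, h2, by rwa [sub_sub_cancel], h4⟩
  have h1'' := comap_localKerOver_le_ker_resOfLe_of_cmScalar_torsion V 2 π (1 - r) v hinf' hsup' hunit'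
    (φ.localPointsMap E) (φ.localPointsMap_smul E) (fun Q ↦ by rw [φ.localPointsMap_pointsMap, hφ]) H'
  -- the equivariant eigen-projectors
  obtain ⟨e, he₁, -, he₃, he⟩ := exists_eigenProjector V 2 π r (1 - r) hinf hsup
  obtain ⟨e', he'₁, he'₂, -, he'⟩ := exists_eigenProjector V 2 π (1 - r) r (by rw [inf_comm]; exact hinf)
    (by rw [sup_comm]; exact hsup)
  have hsum := coe_proj_add_coe_proj V 2 π r (1 - r) e e' he₃ he'₁ he'₂
  -- every level-`n` Kummer class of `PK` dies on `D_v`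
  have hvan : ∀ n : ℕ, resOfLe (V.geomPrimaryTorsion 2) (inf_le_left : ⊤ ⊓ decomp v ≤ ⊤)
      (resSubgroup ⊤ (V.geomPrimaryTorsion 2) (V.kummerMapLevel 2 V.zsmul_geomPoints_surjective_holds n PK)) = 0 := by
    intro n
    set x := resSubgroup ⊤ (V.geomPrimaryTorsion 2) (V.kummerMapLevel 2 V.zsmul_geomPoints_surjective_holds n PK) with hx
    have hxQ : x ∈ ((V.kummerMapPInfty 2 V.zsmul_geomPoints_surjective_holds).range).map (resSubgroup ⊤ (V.geomPrimaryTorsion 2)) := by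
      refine ⟨V.kummerMapPInfty 2 V.zsmul_geomPoints_surjective_holds (PK ⊗ₜ prufGen 2 n), ⟨_, rfl⟩, ?_⟩
      rw [kummerMapPInfty_tmul_prufGen, hx]
    have hdec := resH1Hom_subtype_proj_add_eq V 2 π r (1 - r) ⊤ e e' he he' hsum x
    -- the `W*`-component is a Kummer class (stability (S)), hence zero at `v` by (H1′), hence classical at `v`
    have heQ : resH1Hom (ContinuousMonoidHom.id (⊤ : Subgroup (absoluteGaloisGroup K))) e (fun σ x ↦ he σ x) x ∈
        (((V.kummerMapPInfty 2 V.zsmul_geomPoints_surjective_holds).range).map (resSubgroup ⊤ (V.geomPrimaryTorsion 2))).comap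
          (resH1Hom (ContinuousMonoidHom.id (⊤ : Subgroup (absoluteGaloisGroup K))) (V.endEigenPrimaryTorsion 2 π r).subtype
            (fun _ _ ↦ rfl)) := by
      rw [AddSubgroup.mem_comap]
      exact resSubgroup_kummer_stable V 2 π r (1 - r) hunit e e' he hsum x hxQ
    have he0mem := h1 heQ
    have he0 : resOfLe ↥(V.endEigenPrimaryTorsion 2 π r) (inf_le_left : ⊤ ⊓ decomp v ≤ ⊤)
        (resH1Hom (ContinuousMonoidHom.id (⊤ : Subgroup (absoluteGaloisGroup K))) e (fun σ x ↦ he σ x) x) = 0 :=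
      AddMonoidHom.mem_ker.mp he0mem
    have hecl := ker_resOfLe_le_comap_localKerOver V 2 π r v he0mem
    rw [AddSubgroup.mem_comap] at hecl
    -- the `W*′`-component is classical at `v` (difference of two classical classes), hence zero at `v` by (H1″)′
    have hxcl : x ∈ V.localKerOver 2 ⊤ E :=
      ((map_resSubgroup_kummer_le_map_resSubgroup_selmer V 2).trans (map_resSubgroup_selmer_le_localKerOver_adicCompletion V 2 v)) hxQ
    have he'cl : resH1Hom (ContinuousMonoidHom.id (⊤ : Subgroup (absoluteGaloisGroup K))) e' (fun σ x ↦ he' σ x) x ∈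
        (V.localKerOver 2 ⊤ E).comap
          (resH1Hom (ContinuousMonoidHom.id (⊤ : Subgroup (absoluteGaloisGroup K))) (V.endEigenPrimaryTorsion 2 π (1 - r)).subtype
            (fun _ _ ↦ rfl)) := by
      rw [AddSubgroup.mem_comap]
      have heq : resH1Hom (ContinuousMonoidHom.id (⊤ : Subgroup (absoluteGaloisGroup K))) (V.endEigenPrimaryTorsion 2 π (1 - r)).subtype
            (fun _ _ ↦ rfl) (resH1Hom (ContinuousMonoidHom.id (⊤ : Subgroup (absoluteGaloisGroup K))) e' (fun σ x ↦ he' σ x) x) =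
          x - resH1Hom (ContinuousMonoidHom.id (⊤ : Subgroup (absoluteGaloisGroup K))) (V.endEigenPrimaryTorsion 2 π r).subtype
            (fun _ _ ↦ rfl) (resH1Hom (ContinuousMonoidHom.id (⊤ : Subgroup (absoluteGaloisGroup K))) e (fun σ x ↦ he σ x) x) :=
        eq_sub_of_add_eq' hdec
      rw [heq]
      exact sub_mem hxcl hecl
    have he'0 : resOfLe ↥(V.endEigenPrimaryTorsion 2 π (1 - r)) (inf_le_left : ⊤ ⊓ decomp v ≤ ⊤)
        (resH1Hom (ContinuousMonoidHom.id (⊤ : Subgroup (absoluteGaloisGroup K))) e' (fun σ x ↦ he' σ x) x) = 0 :=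
      AddMonoidHom.mem_ker.mp (h1'' he'cl)
    rw [← hdec, map_add, resOfLe_resH1Hom_subtype V 2 π r, resOfLe_resH1Hom_subtype V 2 π (1 - r), he0, he'0, map_zero, map_zero,
      add_zero]
  -- so `PK ∈ 2^n E(K_v) + tors` for every `n`: `PK` is torsion
  haveI : CharZero E := charZero_of_injective_algebraMap (algebraMap K E).injective
  haveI : (V.baseChange E).IsElliptic := inferInstanceAs ((V.map (algebraMap K E)).IsElliptic)
  set Pimg : localPoints V E := pointsMap V E (toGeomPoints V PK) with hPimg
  set ψ : (V.baseChange E).toAffine.Point →+ localPoints V E :=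
    Affine.Point.map (W' := V) (IsScalarTower.toAlgHom K E (AlgebraicClosure E)) with hψ
  have hψinj : Function.Injective ψ :=
    Affine.Point.map_injective (W' := V) (IsScalarTower.toAlgHom K E (AlgebraicClosure E))
  have hPfix : ∀ σ : absoluteGaloisGroup E, σ • Pimg = Pimg := fun σ ↦ by
    rw [hPimg, ← pointsMap_smul, smul_toGeomPoints]
  obtain ⟨x₀, hx₀⟩ := exists_map_eq_of_forall_smul_localPoints_eq V E hPfix
  have hx₀' : ψ x₀ = Pimg := hx₀
  have hx₀t : IsOfFinAddOrder x₀ := by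
    refine isOfFinAddOrder_of_forall_exists_adicCompletion_two hK2 hv hvbar hne (V.baseChange E) (fun n ↦ ?_)
    obtain ⟨y, T, hy, hT, hyT⟩ := (resOfLe_resSubgroup_kummerMapLevel_eq_zero_iff V 2 v PK n).mp (hvan n)
    obtain ⟨Y, hY⟩ := exists_map_eq_of_forall_smul_localPoints_eq V E hy
    have hY' : ψ Y = y := hY
    refine ⟨Y, ?_⟩
    have h2 : ((2 : ℤ) ^ n) • y + T = Pimg := by
      have e1 : ((2 : ℤ) ^ n) • y = 2 ^ n • y := by
        rw [← natCast_zsmul y (2 ^ n), Nat.cast_pow, Nat.cast_ofNat]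
      rw [e1]
      exact hyT
    have hTeq : ψ (x₀ - ((2 : ℤ) ^ n) • Y) = T := by
      rw [map_sub, map_zsmul, hx₀', hY', ← h2, add_sub_cancel_left]
    exact (hψinj.isOfFinAddOrder_iff).mp (hTeq ▸ hT)
  have hPimgt : IsOfFinAddOrder Pimg := hx₀' ▸ ψ.isOfFinAddOrder hx₀t
  have hinj : Function.Injective (pointsMap V E) := pointsMapOfEmb_injective V (closureEmb (K := K) E)
  rw [hPimg, hinj.isOfFinAddOrder_iff, (toGeomPoints_injective V).isOfFinAddOrder_iff] at hPimgt
  exact hPimgt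

/-- **THE CM SCALAR AT THE PINNED PLACE `v` IS `1 − r`.** On an S3c frame — `C • W = cm7^{(d)}` (`d ≠ 0`), `K` imaginary quadratic, `2 = v·v̄`,
`π ∈ End_K(E_K)` with `π² = π − 2`, `r² = r − 2`, `P ∈ W(ℚ)` of infinite order, `Finite 𝔖_{v̄}(K, W*)` for `W* = E[𝔮_r^∞]` — and for ANY isogeny
`φ` acting as `π` on `E(K̄)`: for every `Γ_{K_v}`-fixed `y ∈ E(K̄_v)` and every `n`, `m·(φ_{K_v} y − N₁ y − 2^n y′) = 0` with `y′` fixed,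
`N₁ ≡ 1 − r (mod 2^n)`, `m ≠ 0`. PROOF: the dichotomy of §1; the branch `c = r` would make the ℚ-generator torsion
(`isOfFinAddOrder_of_cmScalar_eq_root`, with (H1′) := -w3 g9's `comap_kummer_le_ker_resOfLe_of_frame_of_cyclic` fed by (T-loc-cl)
`LocalTrichotomy.classical_local_cyclic` and hfinB′ := -w2 g10's `ConjTransport.finite_restrictedSelmerBase_conj_of_finite`).
[cite: Rubin1999, §3 Lemma 3.6 (ii), Cor. 3.17] [cite: Agboola2007, §6 Prop. 6.11 (arXiv p0014)] [cite: GreenbergLNM1716, §2 Prop. 2.1]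
[cite: SilvermanAEC2009, Prop. VII.6.3] -/
theorem cmScalar_localPoints_of_frame {d : ℤ} (hd0 : d ≠ 0) (W : WeierstrassCurve ℚ) [W.IsElliptic]
    (C : VariableChange ℚ) (hCW : C • W = cm7.quadraticTwist (d : ℚ)) (hK : IsImaginaryQuadratic K)
    (v vbar : HeightOneSpectrum (𝓞 K)) (hv : ((2 : ℕ) : 𝓞 K) ∈ v.asIdeal) (hvbar : ((2 : ℕ) : 𝓞 K) ∈ vbar.asIdeal) (hne : vbar ≠ v)
    (π : (W.baseChange K).endRing) (hrel : (π : AddMonoid.End (W.baseChange K).geomPoints) * π = π - 2)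
    {r : ℤ_[2]} (hr : r * r = r - 2) (P : W.toAffine.Point) (hP : ¬ IsOfFinAddOrder P)
    (hfin : Finite (restrictedSelmerBase ↥((W.baseChange K).endEigenPrimaryTorsion 2 π r) 2 vbar))
    (φ : Isogeny (W.baseChange K) (W.baseChange K)) (hφ : ∀ Q, φ Q = (π : AddMonoid.End (W.baseChange K).geomPoints) Q) :
    ∀ y : localPoints (W.baseChange K) (v.adicCompletion K), (∀ σ : absoluteGaloisGroup (v.adicCompletion K), σ • y = y) →
      ∀ n : ℕ, ∃ (y' : localPoints (W.baseChange K) (v.adicCompletion K)) (N₁ : ℤ) (m : ℤ),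
        (∀ σ : absoluteGaloisGroup (v.adicCompletion K), σ • y' = y') ∧ m ≠ 0 ∧
        ((N₁ : ℤ_[2]) - (1 - r)) ∈ (Ideal.span {(2 : ℤ_[2]) ^ n} : Ideal ℤ_[2]) ∧
        m • (φ.localPointsMap (v.adicCompletion K) y - N₁ • y - 2 ^ n • y') = 0 := by
  haveI : Fact (Nat.Prime 2) := ⟨Nat.prime_two⟩
  have hφ2 : ∀ Q, φ (φ Q) = φ Q - 2 • Q := fun Q ↦ by rw [hφ, hφ, cmEndo_apply_apply (W.baseChange K) hrel Q]
  obtain ⟨c, hc, H⟩ := cmScalar_dichotomy_localPoints hK.1 hv hvbar hne (W.baseChange K) φ hφ2 hr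
  rcases hc with hc | hc
  · -- the branch `c = r` is impossible: the ℚ-generator would be torsion
    exfalso
    subst hc
    obtain ⟨hinf, hsup⟩ := endEigenPrimaryTorsion_compl_of_frame hd0 W C hCW K π hrel hr
    have hfin' := ConjTransport.finite_restrictedSelmerBase_conj_of_finite W K hK v vbar hv hvbar hne π hrel c hfin
    have h1 := comap_kummer_le_ker_resOfLe_of_frame_of_cyclic hd0 W C hCW hK v π hrel hr P hP
      (kummer_local_cyclic_of_classical (W.baseChange K) 2 v (classical_local_cyclic hK hv hvbar hne (W.baseChange K))) hfin'
    exact not_isOfFinAddOrder_map_ofId W hP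
      (isOfFinAddOrder_of_cmScalar_eq_root hK.1 hv hvbar hne (W.baseChange K) π hr hinf hsup φ hφ h1 H
        (Affine.Point.map (W' := W.toAffine) (Algebra.ofId ℚ K) P))
  · subst hc
    exact H

/-! ## §3. The frame consumers: `hPts` of `rBV_of_factor_values_of_cmScalar` VERBATIM, and (H1″) for all local points at `v` -/

/-- **`hPts` of -w8 g2's `rBV_of_factor_values_of_cmScalar` (p671611), VERBATIM, is a theorem**: on every S3c frame there is a
`Γ_{K_v}`-equivariant additive extension `f_v` of `π` to `E(K̄_v)` (the local points map of the isogeny realising `π`) with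
«`2^k·(f_v y − N₁ y − 2^n y′) = 0`, `N₁ ≡ 1 − r (mod 2^n)`» for every fixed `y` and every `n` — (H1-pts) at `v`.
[cite: Rubin1999, §3 Lemma 3.6 (ii), Cor. 3.17] [cite: Agboola2007, §6 Prop. 6.11] [cite: SilvermanAEC2009, III.§4 Thm. 4.8, Prop. VII.6.3] -/
theorem hPts_holds :
    ∀ (d : ℤ), d ≠ 0 → Squarefree d → d % 4 ≠ 1 →
      ∀ (W : WeierstrassCurve ℚ) [W.IsElliptic] [W.IsGloballyMinimal] (C : WeierstrassCurve.VariableChange ℚ),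
        C • W = cm7.quadraticTwist (d : ℚ) → W.analyticRank = 1 →
      ∀ (K : Type) [Field K] [NumberField K], IsImaginaryQuadratic K →
      ∀ (v vbar : HeightOneSpectrum (𝓞 K)),
        ((2 : ℕ) : 𝓞 K) ∈ v.asIdeal → ((2 : ℕ) : 𝓞 K) ∈ vbar.asIdeal → vbar ≠ v →
      ∀ (π : (W.baseChange K).endRing), (π : AddMonoid.End (W.baseChange K).geomPoints) * π = π - 2 →
      ∀ (r : ℤ_[2]), r * r = r - 2 →
        (∀ τ ∈ GreenbergSelmer.inertia v, ∀ x : ↥((W.baseChange K).endEigenPrimaryTorsion 2 π r), τ • x = x ∨ τ • x = -x) →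
      ∀ (P : W.toAffine.Point) (c₀ : ℕ) (ℓ : ℤ),
        ¬ IsOfFinAddOrder P →
        (∀ R : W.toAffine.Point, ∃ (k : ℤ) (T : W.toAffine.Point), IsOfFinAddOrder T ∧ R = k • P + T) →
        c₀ ≠ 0 → (W.baseChange ℚ_[2]).IsInReductionKernel (c₀ • W.toPadicPoint 2 P) →
        ‖(W.baseChange ℚ_[2]).padicLogPoint (c₀ • W.toPadicPoint 2 P) / (c₀ : ℚ_[2])‖ = (2 : ℝ) ^ (-ℓ) →
      Finite (restrictedSelmerBase ↥((W.baseChange K).endEigenPrimaryTorsion 2 π r) 2 vbar) →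
        ∃ fE : localPoints (W.baseChange K) (v.adicCompletion K) →+ localPoints (W.baseChange K) (v.adicCompletion K),
          (∀ (τ : absoluteGaloisGroup (v.adicCompletion K)) (Q : localPoints (W.baseChange K) (v.adicCompletion K)),
              fE (τ • Q) = τ • fE Q) ∧
          (∀ Q : (W.baseChange K).geomPoints, fE (pointsMap (W.baseChange K) (v.adicCompletion K) Q) =
              pointsMap (W.baseChange K) (v.adicCompletion K) ((π : AddMonoid.End (W.baseChange K).geomPoints) Q)) ∧
          ∀ y : localPoints (W.baseChange K) (v.adicCompletion K),
            (∀ σ : absoluteGaloisGroup (v.adicCompletion K), σ • y = y) →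
            ∀ n : ℕ, ∃ (y' : localPoints (W.baseChange K) (v.adicCompletion K)) (N₁ : ℤ) (k : ℕ),
              (∀ σ : absoluteGaloisGroup (v.adicCompletion K), σ • y' = y') ∧
              ((N₁ : ℤ_[2]) - (1 - r)) ∈ (Ideal.span {(2 : ℤ_[2]) ^ n} : Ideal ℤ_[2]) ∧
              2 ^ k • (fE y - N₁ • y - 2 ^ n • y') = 0 := by
  intro d hd0 _ _ W _ _ C hCW _ K _ _ hK v vbar hv hvbar hne π hrel r hr _ P _ _ hP _ _ _ _ hfin
  haveI : Fact (Nat.Prime 2) := ⟨Nat.prime_two⟩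
  have hπg : (π : AddMonoid.End (W.baseChange K).geomPoints) ∈ (W.baseChange K).geomEndRing := (Subring.mem_inf.1 π.2).1
  have hπG := ((W.baseChange K).mem_equivariantSubring_iff _).1 (Subring.mem_inf.1 π.2).2
  obtain ⟨φ, hφπ, -⟩ := exists_isogeny_apply_eq_cmEndo (W.baseChange K) hπg hπG hrel
  exact cmScalar_input_of_isogeny (W.baseChange K) 2 π r v φ hφπ
    (cmScalar_localPoints_of_frame hd0 W C hCW hK v vbar hv hvbar hne π hrel hr P hP hfin φ hφπ)

/-- **(H1″) FOR ALL LOCAL POINTS at the pinned place `v`, on every S3c frame**: a class of `H¹(⊤, W*)` (`W* = E[𝔮_r^∞]`) whose image in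
`H¹(⊤, E[2^∞])` is CLASSICAL at `v` (dies in `H¹(Γ_{K_v}, E(K̄_v))`) is locally ZERO at `v`: `ι_*⁻¹(localKerOver 2 ⊤ K_v) ≤ ker res_{⊤ ⊓ D_v}`.
Equivalently: the `W*`-part of the local Kummer image `E(K_v) ⊗ ℚ₂/ℤ₂ ↪ H¹(K_v, E[2^∞])` is `0` — the local CM input behind -w8 g3's `hα` and the
A‴ CM-check. (-w8 g2 p670747/p671811 ∘ `cmScalar_localPoints_of_frame`.) [cite: GreenbergLNM1716, §2 Prop. 2.1–2.2 (pp. 70–73)]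
[cite: Rubin1999, §3 Lemma 3.6 (ii), Cor. 3.17] [cite: Agboola2007, §3 (arXiv p0008:L8–12), §6 Prop. 6.11] -/
theorem comap_localKerOver_le_ker_resOfLe_of_frame {d : ℤ} (hd0 : d ≠ 0) (W : WeierstrassCurve ℚ) [W.IsElliptic]
    (C : VariableChange ℚ) (hCW : C • W = cm7.quadraticTwist (d : ℚ)) (hK : IsImaginaryQuadratic K)
    (v vbar : HeightOneSpectrum (𝓞 K)) (hv : ((2 : ℕ) : 𝓞 K) ∈ v.asIdeal) (hvbar : ((2 : ℕ) : 𝓞 K) ∈ vbar.asIdeal) (hne : vbar ≠ v)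
    (π : (W.baseChange K).endRing) (hrel : (π : AddMonoid.End (W.baseChange K).geomPoints) * π = π - 2)
    {r : ℤ_[2]} (hr : r * r = r - 2) (P : W.toAffine.Point) (hP : ¬ IsOfFinAddOrder P)
    (hfin : Finite (restrictedSelmerBase ↥((W.baseChange K).endEigenPrimaryTorsion 2 π r) 2 vbar)) :
    ((W.baseChange K).localKerOver 2 ⊤ (v.adicCompletion K)).comap
        (resH1Hom (ContinuousMonoidHom.id _) ((W.baseChange K).endEigenPrimaryTorsion 2 π r).subtype (fun _ _ ↦ rfl)) ≤
      (resOfLe ↥((W.baseChange K).endEigenPrimaryTorsion 2 π r) (inf_le_left : ⊤ ⊓ decomp v ≤ ⊤)).ker := by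
  haveI : Fact (Nat.Prime 2) := ⟨Nat.prime_two⟩
  have hπg : (π : AddMonoid.End (W.baseChange K).geomPoints) ∈ (W.baseChange K).geomEndRing := (Subring.mem_inf.1 π.2).1
  have hπG := ((W.baseChange K).mem_equivariantSubring_iff _).1 (Subring.mem_inf.1 π.2).2
  obtain ⟨φ, hφπ, -⟩ := exists_isogeny_apply_eq_cmEndo (W.baseChange K) hπg hπG hrel
  obtain ⟨hinf, hsup⟩ := endEigenPrimaryTorsion_compl_of_frame hd0 W C hCW K π hrel hr
  have hunit : IsUnit (r - (1 - r)) := (two_dvd_or_two_dvd_one_sub_of_root hr).2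
  exact comap_localKerOver_le_ker_resOfLe_of_cmScalar_torsion (W.baseChange K) 2 π r v hinf hsup hunit
    (φ.localPointsMap (v.adicCompletion K)) (φ.localPointsMap_smul (v.adicCompletion K))
    (fun Q ↦ by rw [φ.localPointsMap_pointsMap, hφπ])
    (cmScalar_localPoints_of_frame hd0 W C hCW hK v vbar hv hvbar hne π hrel hr P hP hfin φ hφπ)

end Summit.BirchSwinnertonDyer.BirchSwinnertonDyer.Theorems.PrintCf2.CMPrimes

end
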